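import Summits.NavierStokesRegularity.NavierStokesRegularity.Theorems.OddMorawetzLocal.Negative.OddMorawetzLocalSymmetryFields

/-!
# Route OddMorawetz — `MorawetzKillsTypeI`, the hyperoctahedral group on basis jets
(item stmt-NavierStokesRegularity-1377, stub `stub_signedPermBasis`)

The hyperoctahedral group `B₃` of the 48 signed coordinate permutations `g = (σ, ε)` of `ℝ³`
(`(signedPerm σ ε x) i = ε i * x (σ⁻¹ i)`) sits inside `O(3)`; the line uses its action on the BASIS of
the jet spaces to turn `O(3)`-invariance of `T := D³m(0)` into sign / orbit relations between the
coefficients of `T`. Three elementary facts, all over Mathlib and the tree's `SymmetryDefs` lemmas: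

* (i) for a smooth density `m` on 3-jets invariant under the simultaneous jet action `jetAct g` of every
  linear isometry `g`, the third derivative at `0` is invariant: `D³m(0)(g·x₁, g·x₂, g·x₃) = D³m(0)(x₁, x₂, x₃)`
  (`m ∘ jetAct g = m`, `jetAct g` is continuous linear with `jetAct g 0 = 0`, and
  `ContinuousLinearMap.iteratedFDeriv_comp_right`);
* (ii) `g eᵢ = ε(σ i) e_{σ i}` (coordinates);
* (iii) the basis `n`-multilinear map `B(i, j) : h ↦ (∏ₛ h_s (j s)) • eᵢ`, written
  `(mkPiRing ℝ (Fin n) (single i 1)).compContinuousLinearMap (fun s => proj (j s))`, is mapped by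
  `mlAct g n` (`A ↦ g ∘ A ∘ (g⁻¹, …, g⁻¹)`) to `(ε(σ i) ∏ₛ ε(σ (j s))) • B(σ i, σ ∘ j)`
  (unfold `mlAct_apply`, use (ii) for the outer `g`, `signedPermLI_symm_apply` for the inner `g⁻¹`,
  `Finset.prod_mul_distrib`).
-/

noncomputable section

set_option linter.dupNamespace false

namespace Summit.NavierStokesRegularity.NavierStokesRegularity.Theorems

open Summit.NavierStokesRegularity.NavierStokesRegularity.Theorems.OddMorawetz

/-- (i) The third derivative at `0` of a smooth density on 3-jets that is invariant under the jet action of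
every linear isometry is invariant under the simultaneous jet action on its three arguments. -/
theorem iteratedFDeriv_three_zero_jetAct {m : Jet3 → ℝ} (hm : ContDiff ℝ (⊤ : ℕ∞) m)
    (hinv : ∀ (g : E3 ≃ₗᵢ[ℝ] E3) (z : Jet3), m (jetAct g z) = m z) (g : E3 ≃ₗᵢ[ℝ] E3)
    (x : Fin 3 → Jet3) :
    iteratedFDeriv ℝ 3 m 0 (fun s => jetAct g (x s)) = iteratedFDeriv ℝ 3 m 0 x := by
  have hcomp : m ∘ ⇑(jetAct g) = m := funext fun z => hinv g z
  have h3 : ContDiff ℝ ((3 : ℕ) : WithTop ℕ∞) m := hm.of_le (ENat.natCast_le_of_coe_top_le_withTop le_rfl 3)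
  have key := ContinuousLinearMap.iteratedFDeriv_comp_right (jetAct g) h3 (0 : Jet3) (i := 3) le_rfl
  rw [hcomp, map_zero] at key
  calc iteratedFDeriv ℝ 3 m 0 (fun s => jetAct g (x s))
      = ((iteratedFDeriv ℝ 3 m 0).compContinuousLinearMap fun _ => jetAct g) x := by
        rw [ContinuousMultilinearMap.compContinuousLinearMap_apply]
    _ = iteratedFDeriv ℝ 3 m 0 x := by rw [← key]

/-- (ii) A signed coordinate permutation `g = (σ, ε)` maps the basis vector `eᵢ` to `ε(σ i) e_{σ i}`. -/
theorem signedPerm_single (σ : Equiv.Perm (Fin 3)) (ε : Fin 3 → ℤˣ) (i : Fin 3) :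
    signedPerm σ ε (EuclideanSpace.single i (1 : ℝ)) =
      ((ε (σ i) : ℤ) : ℝ) • EuclideanSpace.single (σ i) (1 : ℝ) := by
  ext l
  simp only [signedPerm, signedPermLI_apply, PiLp.smul_apply, PiLp.single_apply, smul_eq_mul,
    Equiv.symm_apply_eq]
  by_cases h : l = σ i
  · subst h
    simp
  · simp [h]

/-- (iii) A signed coordinate permutation `g = (σ, ε)` maps the basis multilinear map
`h ↦ (∏ₛ h_s (j s)) • eᵢ` to `(ε(σ i) ∏ₛ ε(σ (j s))) • (h ↦ (∏ₛ h_s (σ (j s))) • e_{σ i})`. -/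
theorem mlAct_signedPerm_basis (σ : Equiv.Perm (Fin 3)) (ε : Fin 3 → ℤˣ) (n : ℕ) (i : Fin 3)
    (j : Fin n → Fin 3) :
    mlAct (signedPerm σ ε) n
        ((ContinuousMultilinearMap.mkPiRing ℝ (Fin n) (EuclideanSpace.single i (1 : ℝ))).compContinuousLinearMap
          (fun s => EuclideanSpace.proj (j s))) =
      (((ε (σ i) : ℤ) : ℝ) * ∏ s, ((ε (σ (j s)) : ℤ) : ℝ)) •
        (ContinuousMultilinearMap.mkPiRing ℝ (Fin n) (EuclideanSpace.single (σ i) (1 : ℝ))).compContinuousLinearMap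
          (fun s => EuclideanSpace.proj (σ (j s))) := by
  refine ContinuousMultilinearMap.ext fun h => ?_
  rw [mlAct_apply]
  simp only [ContinuousMultilinearMap.compContinuousLinearMap_apply, ContinuousMultilinearMap.mkPiRing_apply,
    smul_apply, PiLp.proj_apply, map_smul, signedPerm_single, smul_smul]
  congr 1
  simp only [signedPerm, signedPermLI_symm_apply, Finset.prod_mul_distrib]
  ring

/-- **The hyperoctahedral group on basis jets** (item stmt-NavierStokesRegularity-1377, route OddMorawetz,
stub `stub_signedPermBasis`). (i) The third derivative at `0` of a smooth density invariant under every linear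
isometry is invariant under the simultaneous jet action; (ii) a signed coordinate permutation `g = (σ, ε)` maps
the basis vector `eᵢ` to `ε(σ i) e_{σ i}` and (iii) the basis multilinear map `h ↦ (∏ₛ h_s (j s)) eᵢ` to
`± (∏…) e_{σ i}` with indices `σ ∘ j` and the sign `ε(σ i) ∏ₛ ε(σ (j s))`. -/
theorem stub_signedPermBasis :
    (∀ (m : Jet3 → ℝ), ContDiff ℝ (⊤ : ℕ∞) m → (∀ (g : E3 ≃ₗᵢ[ℝ] E3) (z : Jet3), m (jetAct g z) = m z) →
      ∀ (g : E3 ≃ₗᵢ[ℝ] E3) (x : Fin 3 → Jet3),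
        iteratedFDeriv ℝ 3 m 0 (fun s => jetAct g (x s)) = iteratedFDeriv ℝ 3 m 0 x) ∧
    (∀ (σ : Equiv.Perm (Fin 3)) (ε : Fin 3 → ℤˣ) (i : Fin 3),
      signedPerm σ ε (EuclideanSpace.single i (1 : ℝ)) = ((ε (σ i) : ℤ) : ℝ) • EuclideanSpace.single (σ i) (1 : ℝ)) ∧
    (∀ (σ : Equiv.Perm (Fin 3)) (ε : Fin 3 → ℤˣ) (n : ℕ) (i : Fin 3) (j : Fin n → Fin 3),
      mlAct (signedPerm σ ε) n
          ((ContinuousMultilinearMap.mkPiRing ℝ (Fin n) (EuclideanSpace.single i (1 : ℝ))).compContinuousLinearMap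
            (fun s => EuclideanSpace.proj (j s))) =
        (((ε (σ i) : ℤ) : ℝ) * ∏ s, ((ε (σ (j s)) : ℤ) : ℝ)) •
          (ContinuousMultilinearMap.mkPiRing ℝ (Fin n) (EuclideanSpace.single (σ i) (1 : ℝ))).compContinuousLinearMap
            (fun s => EuclideanSpace.proj (σ (j s)))) :=
  ⟨fun _ hm hinv g x => iteratedFDeriv_three_zero_jetAct hm hinv g x, signedPerm_single,
    mlAct_signedPerm_basis⟩

end Summit.NavierStokesRegularity.NavierStokesRegularity.Theorems
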